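import Mathlib

/-!
# `FoldClosed` — the side condition missing from `stub_rebase` (line torus-descent-sum-shadow)

Drefute evidence (refuter-drefute-stmt-KontsevichZagierPeriods-3912-0).  `FoldClosed k e lam` says: for every
pivot `p` (`lam p = -1`) and every cone index `j` (`lam j = 1`), after deleting the coordinate `p` and adjoining
`j` to every active chord `[i,i']` that contains some other `+1`-coordinate `j' ≠ j`, the resulting family of
coordinate sets has the consecutive-ones property (some reordering of the coordinates makes every set an
interval, the deleted `p` being transparent).  This is exactly the condition under which the docstring
mechanism of `stub_rebase` (cone dissection + monomial fold `y_{j'} = y_j w_{j'}`) lands in `AtomLE k` up to a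
coordinate permutation (rule 2).
-/

set_option linter.dupNamespace false

namespace Summit.KontsevichZagierPeriods.KontsevichZagierPeriods.Cruxes.DihedralNormalForm.Drefute

/-- The folded chord set of the active chord `[i,i']` for pivot `p` and cone `j`. -/
def foldedChord (k : ℕ) (lam : Fin (k+1) → ℤ) (p j i i' : Fin (k+1)) : Finset (Fin (k+1)) :=
  (Finset.univ.filter fun l => i ≤ l ∧ l ≤ i' ∧ l ≠ p) ∪
    (if ∃ j' : Fin (k+1), j' ≠ j ∧ lam j' = 1 ∧ i ≤ j' ∧ j' ≤ i' then {j} else ∅)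

/-- `S` is an interval for the order `σ`, the coordinate `p` being transparent. -/
def IsIntervalMod (k : ℕ) (σ : Equiv.Perm (Fin (k+1))) (p : Fin (k+1)) (S : Finset (Fin (k+1))) : Prop :=
  ∀ l₁ ∈ S, ∀ l₂ ∈ S, ∀ l : Fin (k+1), σ l₁ ≤ σ l → σ l ≤ σ l₂ → l ≠ p → l ∈ S

instance (k : ℕ) (σ : Equiv.Perm (Fin (k+1))) (p : Fin (k+1)) (S : Finset (Fin (k+1))) :
    Decidable (IsIntervalMod k σ p S) := by
  unfold IsIntervalMod; infer_instance

/-- The fold-closure side condition. -/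
def FoldClosed (k : ℕ) (e : Fin (k+1) → Fin (k+1) → ℤ) (lam : Fin (k+1) → ℤ) : Prop :=
  ∀ p : Fin (k+1), lam p = -1 → ∀ j : Fin (k+1), lam j = 1 →
    ∃ σ : Equiv.Perm (Fin (k+1)), ∀ i i' : Fin (k+1), i ≤ i' → e i i' ≠ 0 →
      IsIntervalMod k σ p (foldedChord k lam p j i i')

/-- The minimal K3 witness (dimension k+1 = 5): chords {[0,1],[1,2],[3,4]} as poles, lam = (1,-1,1,1,-1). -/
def eW : Fin 5 → Fin 5 → ℤ := fun i j =>
  if (i.val, j.val) ∈ [((0:ℕ),(1:ℕ)), (1,2), (3,4)] then -1 else 0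

def lamW : Fin 5 → ℤ := ![1, -1, 1, 1, -1]

/-- `lamW` is a SIMPLE descent direction for `eW` in the sense of the skeleton (entries in {0,±1}, a `-1`,
every active chord has sum 0 and at most one `+1`), with `E = 1` for the monomial `a = 0`. -/
theorem lamW_simple :
    (∀ l : Fin 5, lamW l = 0 ∨ lamW l = 1 ∨ lamW l = -1) ∧ (∃ p : Fin 5, lamW p = -1) ∧
    (∀ i j : Fin 5, i ≤ j → eW i j ≠ 0 →
      (∑ l : Fin 5, if i ≤ l ∧ l ≤ j then lamW l else 0) = 0 ∧
      (Finset.univ.filter (fun l : Fin 5 => i ≤ l ∧ l ≤ j ∧ lamW l = 1)).card ≤ 1) ∧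
    (∑ l : Fin 5, lamW l * (((fun _ => (0:ℕ)) l : ℤ) + 1)) ≠ 0 := by
  decide

set_option maxRecDepth 1000000 in
set_option maxHeartbeats 4000000 in
/-- **K3 fails for the witness**: no coordinate order re-cubes the cone `j = 3` of the pivot `p = 1`. -/
theorem not_foldClosed_witness : ¬ FoldClosed 4 eW lamW := by
  intro h
  obtain ⟨σ, hσ⟩ := h 1 (by decide) 3 (by decide)
  revert σ
  decide

/-- The path chords `[i,i+1]` of the cell form ω₀(M_{0,8}) = `1/((1-x₀x₁)(1-x₁x₂)(1-x₂x₃)(1-x₃x₄))` (all poles). -/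
def eP : Fin 5 → Fin 5 → ℤ := fun i j => if j.val = i.val + 1 then -1 else 0

/-- The two descent directions of ω₀(M_{0,8}) (the only ones: orthogonality to the four path chords forces
`lam = ±(1,-1,1,-1,1)`). -/
def lamP : Fin 5 → ℤ := ![1, -1, 1, -1, 1]
def lamP' : Fin 5 → ℤ := ![-1, 1, -1, 1, -1]

/-- Both are SIMPLE directions with `E = ±1` for `a = 0`. -/
theorem lamP_simple :
    (∀ lam ∈ [lamP, lamP'],
      (∀ l : Fin 5, lam l = 0 ∨ lam l = 1 ∨ lam l = -1) ∧ (∃ p : Fin 5, lam p = -1) ∧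
      (∀ i j : Fin 5, i ≤ j → eP i j ≠ 0 →
        (∑ l : Fin 5, if i ≤ l ∧ l ≤ j then lam l else 0) = 0 ∧
        (Finset.univ.filter (fun l : Fin 5 => i ≤ l ∧ l ≤ j ∧ lam l = 1)).card ≤ 1) ∧
      (∑ l : Fin 5, lam l * (((fun _ => (0:ℕ)) l : ℤ) + 1)) ≠ 0) := by
  decide

set_option maxRecDepth 1000000 in
set_option maxHeartbeats 4000000 in
/-- Orthogonality to the path chords pins the direction: any `lam ∈ {0,±1}⁵` (encoded by `Fin 3`, value − 1)
orthogonal to the four chords `[i,i+1]` is `0` or `±(1,-1,1,-1,1)`. -/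
theorem path_directions (c : Fin 5 → Fin 3)
    (horth : ∀ i : Fin 4, ((c i.castSucc).val : ℤ) - 1 + (((c i.succ).val : ℤ) - 1) = 0) :
    (fun l => ((c l).val : ℤ) - 1) = lamP ∨ (fun l => ((c l).val : ℤ) - 1) = lamP' ∨
      (fun l => ((c l).val : ℤ) - 1) = 0 := by
  revert c
  decide

set_option maxRecDepth 1000000 in
set_option maxHeartbeats 4000000 in
/-- **K3 fails for ω₀(M_{0,8}) in both directions** (pivot 1 / cone 4, resp. pivot 0 / cone 3): the skeleton's
path `sdAtom_red = stub_torusDescent ▸ stub_rebase` has no re-cubing mechanism for the cell form of M_{0,8},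
and the atom is dihedrally invariant (no rule-2 symmetry changes it). -/
theorem not_foldClosed_omega0_M08 : ¬ FoldClosed 4 eP lamP ∧ ¬ FoldClosed 4 eP lamP' := by
  constructor
  · intro h
    obtain ⟨σ, hσ⟩ := h 1 (by decide) 4 (by decide)
    revert σ
    decide
  · intro h
    obtain ⟨σ, hσ⟩ := h 0 (by decide) 3 (by decide)
    revert σ
    decide

end Summit.KontsevichZagierPeriods.KontsevichZagierPeriods.Cruxes.DihedralNormalForm.Drefute
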